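import Summits.Parity.GeneralizedHardyLittlewood.Theorems.GreenTaoLevelTwoMNTwoMajorArcOfDivisors

/-!
# Route `GreenTaoLevelTwo`, crux `MNTwo` (stmt-Parity-21276), line `birth`, stub `stub_mnVertical`:
# §11 with the parameters chosen: Prop. 22 at one scale ⇒ the conclusion of the inverse statement

Block H6 (§11 side) of the `stub_mnVertical` census (B. Green, T. Tao, *Quadratic uniformity of the
Möbius function*, Ann. Inst. Fourier 58 (2008) = arXiv:math/0606087, §11: "We will choose
`ρ₁ := log^{-C₂(A+1)}N` … `ρ₂ = log^{-C₄(A+1)}N` … the implied constants in the `≲` notation have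
become heavily dependent on `d`").  In `…MNTwoMajorArcOfDivisors.majorArc_of_divisors` all
parameters are free; here they are CHOSEN in terms of one "polylogarithmic budget" `P`
(in the application `P = log^{C(A+1)}N`): `ρ₁ = P^{-(k+2)(4+4^{k+2})}`, `r = k + 2`, `Q = P`,
`ε = Pρ₁²`, `ρ₂ = P^{-b₂}`, and all the side conditions of Prop. 25 / Lemmas 26–28 are verified for
`P ≥ P₀(k)`; the output is literally the shape of the conclusion of the tree's major-arc inverse
statement `hInv` (`…MNTwoVerticalOfInverseLargeN`): `∃ q K ρ₃, 1 ≤ q ≤ P^B, 0 ≤ K ≤ P^B,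
P^{-B} ≤ ρ₃ ≤ ρ, ∀ a b ∈ B(ρ₃), ‖q•φ''(a,b)‖ ≤ K ν(a)ν(b)` with `B = B(k)`.  The INPUT is the
conclusion of Proposition 22 at the single scale `ρ₁` with budget `P` (divisors `𝒟 ⊆ [1,D]` with
`ρ₁D²/P ≤ #𝒟²`, the Prop-25 size condition `4·32·38ᵏD ≤ (ρ₁/16)^{k+1}N/2`, and
`‖qφ''(n,n)‖ ≤ Pρ₁²` for some `1 ≤ q ≤ P` at every multiple `n ∈ B(ρ₁)` of every `d ∈ 𝒟`) — to be
supplied by §10 (Lemmas 23, 24 via `…MNTwoScaleOfProgression`).  Def-free.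

* `majorArc_of_prop22` — the statement just described.

References: [GreenTao2008QuadraticMobius] arXiv:math/0606087 §11.
-/

noncomputable section

open Finset Real

namespace Summit.Parity.GeneralizedHardyLittlewood.GreenTaoLevelTwoMNTwoMajorArcOfPropTwentyTwo

open Summit.Parity.GeneralizedHardyLittlewood.GreenTaoLevelTwoMNTwoMajorArcOfDivisors
  (majorArc_of_divisors)
open Summit.Parity.GeneralizedHardyLittlewood.GreenTaoLevelTwoMNTwoBohrGauge (bohrGauge_nonneg)
set_option maxHeartbeats 400000 in
/-- **GT 2008b §11 with parameters chosen (one polylogarithmic budget `P`).**  For every `k` there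
are `B ∈ ℕ` and `P₀` such that for all `P ≥ P₀`, `N ≥ 1` with `1 + log N ≤ P`, frequencies
`α : Fin k → ℝ`, `P⁻¹ ≤ ρ < 10⁻⁵`, `φ : ℤ → ℝ/ℤ` locally quadratic on `B(n₀,100ρ)` for the rotation
gauge `ν(n) = maxᵢ‖nαᵢ‖ + |n|/N`: IF the conclusion of Proposition 22 holds at the scale
`ρ₁ = P^{-(k+2)(4+4^{k+2})}` with budget `P` (see the module docstring), THEN there are `q, K, ρ₃`
with `1 ≤ q ≤ P^B`, `0 ≤ K ≤ P^B`, `P^{-B} ≤ ρ₃ ≤ ρ` and `‖q•φ''(a,b)‖ ≤ Kν(a)ν(b)` for all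
`a, b ∈ B(ρ₃)`. [cite: GreenTao2008QuadraticMobius, §11 (choice of `ρ₁, ρ₂`, Lemma 28)] -/
theorem majorArc_of_prop22 (k : ℕ) :
    ∃ (B : ℕ) (P₀ : ℝ), ∀ (P : ℝ), P₀ ≤ P → ∀ (N : ℕ), 1 ≤ N → 1 + Real.log N ≤ P →
      ∀ (α : Fin k → ℝ) (n₀ : ℤ) (ρ : ℝ), P⁻¹ ≤ ρ → 100000 * ρ < 1 →
      ∀ (φ : ℤ → UnitAddCircle),
        (∀ n a b c : ℤ,
          (⨆ i : Fin k, ‖((((n - n₀ : ℤ) : ℝ) * α i : ℝ) : AddCircle (1 : ℝ))‖) +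
              |((n - n₀ : ℤ) : ℝ)| / N < 100 * ρ →
          (⨆ i : Fin k, ‖((((n + a - n₀ : ℤ) : ℝ) * α i : ℝ) : AddCircle (1 : ℝ))‖) +
              |((n + a - n₀ : ℤ) : ℝ)| / N < 100 * ρ →
          (⨆ i : Fin k, ‖((((n + b - n₀ : ℤ) : ℝ) * α i : ℝ) : AddCircle (1 : ℝ))‖) +
              |((n + b - n₀ : ℤ) : ℝ)| / N < 100 * ρ →
          (⨆ i : Fin k, ‖((((n + c - n₀ : ℤ) : ℝ) * α i : ℝ) : AddCircle (1 : ℝ))‖) +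
              |((n + c - n₀ : ℤ) : ℝ)| / N < 100 * ρ →
          (⨆ i : Fin k, ‖((((n + a + b - n₀ : ℤ) : ℝ) * α i : ℝ) : AddCircle (1 : ℝ))‖) +
              |((n + a + b - n₀ : ℤ) : ℝ)| / N < 100 * ρ →
          (⨆ i : Fin k, ‖((((n + a + c - n₀ : ℤ) : ℝ) * α i : ℝ) : AddCircle (1 : ℝ))‖) +
              |((n + a + c - n₀ : ℤ) : ℝ)| / N < 100 * ρ →
          (⨆ i : Fin k, ‖((((n + b + c - n₀ : ℤ) : ℝ) * α i : ℝ) : AddCircle (1 : ℝ))‖) +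
              |((n + b + c - n₀ : ℤ) : ℝ)| / N < 100 * ρ →
          (⨆ i : Fin k, ‖((((n + a + b + c - n₀ : ℤ) : ℝ) * α i : ℝ) : AddCircle (1 : ℝ))‖) +
              |((n + a + b + c - n₀ : ℤ) : ℝ)| / N < 100 * ρ →
          φ (n + a + b + c) - φ (n + a + b) - φ (n + a + c) - φ (n + b + c)
            + φ (n + a) + φ (n + b) + φ (n + c) - φ n = 0) →
        (∀ ρ₁ : ℝ, ρ₁ = (P ^ ((k + 2) * (4 + 4 ^ (k + 2))))⁻¹ →
          ∃ (D : ℕ) (𝒟 : Finset ℕ), 1 ≤ D ∧ 𝒟 ⊆ Icc 1 D ∧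
            4 * (32 * 38 ^ k) * (D : ℝ) ≤ (ρ₁ / 16) ^ (k + 1) * N / 2 ∧
            ρ₁ * (D : ℝ) ^ 2 / P ≤ (#𝒟 : ℝ) ^ 2 ∧
            ∀ d ∈ 𝒟, ∀ n ∈ (Finset.Ioo (-(N : ℤ)) N).filter fun n : ℤ =>
                (∀ i, ‖(((n : ℝ) * α i : ℝ) : AddCircle (1 : ℝ))‖ + |(n : ℝ)| / N < ρ₁) ∧
                  |(n : ℝ)| / N < ρ₁,
              (d : ℤ) ∣ n → ∃ q : ℕ, 1 ≤ q ∧ (q : ℝ) ≤ P ∧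
                ‖((q : ℤ)) • (φ (n₀ + n + n) - φ (n₀ + n) - φ (n₀ + n) + φ n₀)‖ ≤ P * ρ₁ ^ 2) →
        ∃ (q : ℕ) (K ρ₃ : ℝ), 1 ≤ q ∧ (q : ℝ) ≤ P ^ B ∧ 0 ≤ K ∧ K ≤ P ^ B ∧
          (P ^ B)⁻¹ ≤ ρ₃ ∧ ρ₃ ≤ ρ ∧
          ∀ a b : ℤ,
            (⨆ i : Fin k, ‖(((a : ℝ) * α i : ℝ) : AddCircle (1 : ℝ))‖) + |(a : ℝ)| / N < ρ₃ →
            (⨆ i : Fin k, ‖(((b : ℝ) * α i : ℝ) : AddCircle (1 : ℝ))‖) + |(b : ℝ)| / N < ρ₃ →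
            ‖q • (φ (n₀ + a + b) - φ (n₀ + a) - φ (n₀ + b) + φ n₀)‖ ≤
              K * ((⨆ i : Fin k, ‖(((a : ℝ) * α i : ℝ) : AddCircle (1 : ℝ))‖) + |(a : ℝ)| / N) *
                ((⨆ i : Fin k, ‖(((b : ℝ) * α i : ℝ) : AddCircle (1 : ℝ))‖) + |(b : ℝ)| / N) := by
  classical
  obtain ⟨A, C, hC1, hdiv⟩ := majorArc_of_divisors
  -- exponents (all natural numbers depending on `k` and the absolute `A`)
  obtain ⟨M, hM⟩ : ∃ M : ℕ, M = 4 ^ (k + 2) := ⟨_, rfl⟩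
  set m : ℕ := 4 + M with hm
  set e₁ : ℕ := (k + 2) * m with he₁
  set s : ℕ := e₁ + 1 + m * (k + 1) + M with hs
  set t : ℕ := s + 2 with ht
  set u : ℕ := 2 + t * A with hu
  set w : ℕ := 1 + t * A + e₁ * 2 with hw
  set b₂ : ℕ := 1 + 3 * u + w with hb₂
  set X : ℕ := (1 + 6 * u) * ((k + 1) * (k + 1)) with hX
  set B : ℕ := X + (1 + 13 * u + w) + 1 + b₂ + 1 with hB
  clear_value m e₁ s t u w b₂ X B
  -- constants
  set c₁ : ℝ := (1 / (2 * (32 * 38 ^ k))) ^ 2 * (1 / (4 * (32 * 38 ^ k))) *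
    ((1 / 16) ^ (k + 1) / 8) with hc₁
  have hc₁pos : 0 < c₁ := by rw [hc₁]; positivity
  set Ck : ℝ := 5 * ((k : ℝ) + 1) ^ 2 * 2 ^ ((k + 1) * (k + 3)) with hCk
  have hCkpos : 0 < Ck := by rw [hCk]; positivity
  have hCk1 : 1 ≤ Ck := by
    rw [hCk]
    have h1 : (1 : ℝ) ≤ ((k : ℝ) + 1) ^ 2 :=
      one_le_pow₀ (by linarith [(Nat.cast_nonneg k : (0:ℝ) ≤ k)])
    have h2 : (1 : ℝ) ≤ 2 ^ ((k + 1) * (k + 3)) := one_le_pow₀ (by norm_num)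
    nlinarith
  clear_value Ck c₁
  refine ⟨B, max (max 4 C) (max (4 / c₁) (max 426133840896 (Ck ^ 2))), ?_⟩
  intro P hP N hN hlogP α n₀ ρ hρP hρ1 φ hφ hP22
  -- size of `P`
  have hP4 : 4 ≤ P := le_trans (le_max_left _ _) (le_trans (le_max_left _ _) hP)
  have hPC : C ≤ P := le_trans (le_max_right _ _) (le_trans (le_max_left _ _) hP)
  have hPc₁ : 4 / c₁ ≤ P := le_trans (le_max_left _ _) (le_trans (le_max_right _ _) hP)
  have hPbig : 426133840896 ≤ P :=
    le_trans (le_max_left _ _) (le_trans (le_max_right _ _) (le_trans (le_max_right _ _) hP))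
  have hPCk : Ck ^ 2 ≤ P :=
    le_trans (le_max_right _ _) (le_trans (le_max_right _ _) (le_trans (le_max_right _ _) hP))
  have hP1 : 1 ≤ P := by linarith
  have hP0 : 0 < P := by linarith
  have hPCk' : Ck ≤ P := by
    have : Ck ≤ Ck ^ 2 := by
      calc Ck = Ck * 1 := (mul_one Ck).symm
        _ ≤ Ck * Ck := mul_le_mul_of_nonneg_left hCk1 hCkpos.le
        _ = Ck ^ 2 := (pow_two Ck).symm
    exact this.trans hPCk
  have hc₁P : 4 ≤ c₁ * P := by rw [div_le_iff₀ hc₁pos] at hPc₁; linarith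
  have hNpos : (0 : ℝ) < N := by exact_mod_cast hN
  have hρpos : 0 < ρ := lt_of_lt_of_le (by positivity) hρP
  have hPinv_le : ∀ n : ℕ, 1 ≤ n → (P ^ n)⁻¹ ≤ P⁻¹ := fun n hn => by
    apply inv_anti₀ hP0
    calc P = P ^ 1 := (pow_one P).symm
      _ ≤ P ^ n := pow_le_pow_right₀ hP1 hn
  -- the scale `ρ₁`
  set ρ₁ : ℝ := (P ^ e₁)⁻¹ with hρ₁
  have hρ₁pos : 0 < ρ₁ := by rw [hρ₁]; positivity
  clear_value ρ₁
  have he₁1 : 1 ≤ e₁ := by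
    have : 0 < e₁ := by rw [he₁, hm]; positivity
    omega
  have hρ₁P : ρ₁ ≤ P⁻¹ := by rw [hρ₁]; exact hPinv_le e₁ he₁1
  have hρ₁4 : ρ₁ ≤ 1 / 4 := by
    refine hρ₁P.trans ?_
    rw [one_div]; exact inv_anti₀ (by norm_num) hP4
  have hρ₁ρ : ρ₁ ≤ ρ := hρ₁P.trans hρP
  have hR9 : 9 * ρ₁ ≤ 100 * ρ := by linarith
  -- Prop. 22 data at scale `ρ₁`
  obtain ⟨D, 𝒟, hD, h𝒟, hlarge, hdens, hgood⟩ := hP22 ρ₁ (by rw [hρ₁, he₁, hm, hM])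
  have hDpos : (0 : ℝ) < D := by exact_mod_cast hD
  have h𝒟1 : 1 ≤ #𝒟 := by
    have h1 : 0 < ρ₁ * (D : ℝ) ^ 2 / P := by positivity
    have h2 : (0 : ℝ) < (#𝒟 : ℝ) ^ 2 := lt_of_lt_of_le h1 hdens
    have h3 : (#𝒟 : ℝ) ≠ 0 := fun h => by rw [h] at h2; simp at h2
    have h4 : #𝒟 ≠ 0 := by exact_mod_cast h3
    omega
  -- the density `σ` and its lower bound `c₁ (P^s)⁻¹ ≤ σ`
  set σ : ℝ := (1 / (2 * (32 * 38 ^ k) * (D : ℝ))) ^ 2 * (#𝒟 : ℝ) ^ 2 * (1 / (4 * (32 * 38 ^ k))) *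
    (((ρ₁ / 16) ^ (k + 1) / 8) / (1 + Real.log N) ^ (4 ^ (k + 2))) ^ ((1 : ℝ) / (k + 2 : ℕ))
    with hσ
  have hlog0 : 0 ≤ Real.log N := Real.log_nonneg (by exact_mod_cast hN)
  have hlog1 : (1 : ℝ) ≤ 1 + Real.log N := by linarith
  have hσlow : c₁ * (P ^ s)⁻¹ ≤ σ := by
    set Y : ℝ := (P ^ (m * (k + 1)))⁻¹ with hY
    set W : ℝ := ((1 / 16 : ℝ) ^ (k + 1) / 8) / (1 + Real.log N) ^ (4 ^ (k + 2)) with hW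
    have hY0 : 0 ≤ Y := by rw [hY]; positivity
    have hW0 : 0 < W := by rw [hW]; positivity
    have hW1 : W ≤ 1 := by
      rw [hW, div_le_one (by positivity)]
      have h1 : (1 / 16 : ℝ) ^ (k + 1) ≤ 1 := pow_le_one₀ (by norm_num) (by norm_num)
      have h2 : (1 : ℝ) ≤ (1 + Real.log N) ^ (4 ^ (k + 2)) := one_le_pow₀ hlog1
      linarith
    have hZ : ((ρ₁ / 16) ^ (k + 1) / 8) / (1 + Real.log N) ^ (4 ^ (k + 2)) = Y ^ (k + 2) * W := by
      rw [hY, hW, hρ₁, he₁]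
      field_simp
      ring
    have hroot : Y * W ≤ (((ρ₁ / 16) ^ (k + 1) / 8) / (1 + Real.log N) ^ (4 ^ (k + 2))) ^
        ((1 : ℝ) / (k + 2 : ℕ)) := by
      rw [hZ, Real.mul_rpow (by positivity) hW0.le, one_div,
        Real.pow_rpow_inv_natCast hY0 (by omega : k + 2 ≠ 0)]
      refine mul_le_mul_of_nonneg_left ?_ hY0
      calc W = W ^ (1 : ℝ) := (Real.rpow_one W).symm
        _ ≤ W ^ (((k + 2 : ℕ) : ℝ)⁻¹) := by
            refine Real.rpow_le_rpow_of_exponent_ge hW0 hW1 ?_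
            rw [inv_le_comm₀ (by positivity) one_pos, inv_one]
            exact_mod_cast (by omega : 1 ≤ k + 2)
    have hWlow : ((1 / 16 : ℝ) ^ (k + 1) / 8) * (P ^ M)⁻¹ ≤ W := by
      rw [hW, div_eq_mul_inv (((1 / 16 : ℝ) ^ (k + 1) / 8)), hM]
      refine mul_le_mul_of_nonneg_left ?_ (by positivity)
      exact inv_anti₀ (by positivity) (pow_le_pow_left₀ (by positivity) hlogP _)
    have hdens' : ρ₁ / P ≤ (1 / (D : ℝ)) ^ 2 * (#𝒟 : ℝ) ^ 2 := by
      have e : (1 / (D : ℝ)) ^ 2 * (#𝒟 : ℝ) ^ 2 = (#𝒟 : ℝ) ^ 2 / (D : ℝ) ^ 2 := by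
        field_simp
      rw [e, le_div_iff₀ (by positivity)]
      rw [div_le_iff₀ hP0] at hdens
      have : ρ₁ / P * (D : ℝ) ^ 2 = ρ₁ * (D : ℝ) ^ 2 / P := by ring
      rw [this, div_le_iff₀ hP0]
      exact hdens
    have e : σ = (1 / (2 * (32 * 38 ^ k))) ^ 2 * ((1 / (D : ℝ)) ^ 2 * (#𝒟 : ℝ) ^ 2) *
        (1 / (4 * (32 * 38 ^ k))) *
        (((ρ₁ / 16) ^ (k + 1) / 8) / (1 + Real.log N) ^ (4 ^ (k + 2))) ^
          ((1 : ℝ) / (k + 2 : ℕ)) := by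
      rw [hσ]; ring
    rw [e]
    have step1 : c₁ * (P ^ s)⁻¹ =
        (1 / (2 * (32 * 38 ^ k))) ^ 2 * (ρ₁ / P) * (1 / (4 * (32 * 38 ^ k))) *
          (Y * (((1 / 16 : ℝ) ^ (k + 1) / 8) * (P ^ M)⁻¹)) := by
      rw [hc₁, hY, hρ₁, hs, he₁]
      field_simp
      ring
    rw [step1]
    calc (1 / (2 * (32 * 38 ^ k))) ^ 2 * (ρ₁ / P) * (1 / (4 * (32 * 38 ^ k))) *
          (Y * (((1 / 16 : ℝ) ^ (k + 1) / 8) * (P ^ M)⁻¹))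
        ≤ (1 / (2 * (32 * 38 ^ k))) ^ 2 * ((1 / (D : ℝ)) ^ 2 * (#𝒟 : ℝ) ^ 2) *
          (1 / (4 * (32 * 38 ^ k))) * (Y * W) := by
          gcongr
      _ ≤ _ := by gcongr
  have hσpos : 0 < σ := lt_of_lt_of_le (by positivity) hσlow
  clear_value σ
  -- `4Qε ≤ σ` with `Q = P`, `ε = Pρ₁²` (this is where `m = 4 + 4^{k+2}` is used)
  have hQε : 4 * P * (P * ρ₁ ^ 2) ≤ σ := by
    refine le_trans ?_ hσlow
    have hPs : P ^ s ≠ 0 := by positivity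
    have key : 4 * P * (P * ρ₁ ^ 2) * P ^ s = 4 * P⁻¹ := by
      rw [hρ₁, hs, he₁, hm]
      field_simp
      ring
    have h1 : 4 * P * (P * ρ₁ ^ 2) = 4 * P⁻¹ * (P ^ s)⁻¹ :=
      (eq_mul_inv_iff_mul_eq₀ hPs).2 key
    rw [h1]
    refine mul_le_mul_of_nonneg_right ?_ (by positivity)
    calc 4 * P⁻¹ = 4 / P := by ring
      _ ≤ c₁ := by rw [div_le_iff₀ hP0]; linarith
  -- the scale `ρ₂`
  set ρ₂ : ℝ := (P ^ b₂)⁻¹ with hρ₂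
  have hρ₂pos : 0 < ρ₂ := by rw [hρ₂]; positivity
  clear_value ρ₂
  have hb₂1 : 1 ≤ b₂ := by rw [hb₂]; omega
  have hρ₂P : ρ₂ ≤ P⁻¹ := by rw [hρ₂]; exact hPinv_le b₂ hb₂1
  have hR18 : 18 * ρ₂ ≤ 100 * ρ := by linarith [hρ₂P.trans hρP]
  -- `P/σ ≤ P^t`
  have hPσ : P / σ ≤ P ^ t := by
    rw [div_le_iff₀ hσpos]
    have h1 : P ^ t * (c₁ * (P ^ s)⁻¹) = c₁ * P * P := by
      rw [ht]; field_simp; ring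
    have h2 : 1 ≤ c₁ * P := by linarith [hc₁P]
    calc P = 1 * P := (one_mul P).symm
      _ ≤ c₁ * P * P := mul_le_mul_of_nonneg_right h2 hP0.le
      _ = P ^ t * (c₁ * (P ^ s)⁻¹) := h1.symm
      _ ≤ P ^ t * σ := mul_le_mul_of_nonneg_left hσlow (by positivity)
  have hPσ0 : 0 ≤ P / σ := by positivity
  have hPσA : (P / σ) ^ A ≤ P ^ (t * A) := by
    rw [pow_mul]; exact pow_le_pow_left₀ hPσ0 hPσ A
  -- `Q₁ ≤ P^u`, `K₁ ≤ P^w`, `648Q₁³K₁ρ₂² ≤ 1`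
  have hQ₁ : C * P * (P / σ) ^ A ≤ P ^ u := by
    have h1 : C * P ≤ P ^ 2 := by rw [pow_two]; exact mul_le_mul_of_nonneg_right hPC hP0.le
    calc C * P * (P / σ) ^ A ≤ P ^ 2 * P ^ (t * A) :=
          mul_le_mul h1 hPσA (by positivity) (by positivity)
      _ = P ^ u := by rw [hu, pow_add]
  have hK₁ : C * (P / σ) ^ A / ρ₁ ^ 2 ≤ P ^ w := by
    have e : C * (P / σ) ^ A / ρ₁ ^ 2 = C * (P / σ) ^ A * P ^ (e₁ * 2) := by
      rw [hρ₁, inv_pow, div_inv_eq_mul, ← pow_mul]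
    rw [e]
    calc C * (P / σ) ^ A * P ^ (e₁ * 2) ≤ P * P ^ (t * A) * P ^ (e₁ * 2) := by gcongr
      _ = P ^ w := by rw [hw]; ring
  have hsmall : 648 * (C * P * (P / σ) ^ A) ^ 3 * (C * (P / σ) ^ A / ρ₁ ^ 2) * ρ₂ ^ 2 ≤ 1 := by
    have h648 : (648 : ℝ) ≤ P := by linarith
    calc 648 * (C * P * (P / σ) ^ A) ^ 3 * (C * (P / σ) ^ A / ρ₁ ^ 2) * ρ₂ ^ 2
        ≤ P * (P ^ u) ^ 3 * P ^ w * ρ₂ ^ 2 := by gcongr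
      _ = (P ^ b₂)⁻¹ := by rw [hρ₂, hb₂]; field_simp; ring
      _ ≤ 1 := inv_le_one_of_one_le₀ (one_le_pow₀ hP1)
  -- §11
  obtain ⟨q, hq1, hqQ, hqb⟩ := hdiv k N hN α φ n₀ (100 * ρ) hφ ρ₁ (P * ρ₁ ^ 2) P hρ₁pos hρ₁4
    hR9 hP1 (by positivity) D hD 𝒟 h𝒟 h𝒟1 hlarge hgood (k + 2) (by omega) σ (by rw [hσ]) hQε ρ₂
    hρ₂pos hR18 hsmall
  have hC0 : 0 < C := by linarith
  have hK0 : (0 : ℝ) ≤ (25672 * (C * P * (P / σ) ^ A) ^ 6) ^ ((k + 1) * (k + 1)) *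
      (426133840896 * (C * P * (P / σ) ^ A) ^ 13 * (C * (P / σ) ^ A / ρ₁ ^ 2)) * Ck ^ 2 := by
    have h1 : 0 ≤ P / σ := hPσ0
    positivity
  refine ⟨q, (25672 * (C * P * (P / σ) ^ A) ^ 6) ^ ((k + 1) * (k + 1)) *
      (426133840896 * (C * P * (P / σ) ^ A) ^ 13 * (C * (P / σ) ^ A / ρ₁ ^ 2)) * Ck ^ 2,
    ρ₂ / Ck, hq1, ?_, hK0, ?_, ?_, ?_, ?_⟩
  · -- `q ≤ P^B`
    refine hqQ.trans ?_
    have h25672 : (25672 : ℝ) ≤ P := le_trans (by norm_num) hPbig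
    have hQ₁0 : 0 ≤ C * P * (P / σ) ^ A := by positivity
    have hQ₁6 : (C * P * (P / σ) ^ A) ^ 6 ≤ (P ^ u) ^ 6 := pow_le_pow_left₀ hQ₁0 hQ₁ 6
    have hQ₂le : 25672 * (C * P * (P / σ) ^ A) ^ 6 ≤ P * (P ^ u) ^ 6 :=
      mul_le_mul h25672 hQ₁6 (by positivity) hP0.le
    have hXB : X ≤ B := by rw [hB]; omega
    calc (25672 * (C * P * (P / σ) ^ A) ^ 6) ^ ((k + 1) * (k + 1))
        ≤ (P * (P ^ u) ^ 6) ^ ((k + 1) * (k + 1)) := pow_le_pow_left₀ (by positivity) hQ₂le _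
      _ = P ^ X := by rw [hX]; ring
      _ ≤ P ^ B := pow_le_pow_right₀ hP1 hXB
  · -- `K ≤ P^B`
    have h25672 : (25672 : ℝ) ≤ P := le_trans (by norm_num) hPbig
    have hQ₁0 : 0 ≤ C * P * (P / σ) ^ A := by positivity
    have hK₁0 : 0 ≤ C * (P / σ) ^ A / ρ₁ ^ 2 := by positivity
    have hQ₁6 : (C * P * (P / σ) ^ A) ^ 6 ≤ (P ^ u) ^ 6 := pow_le_pow_left₀ hQ₁0 hQ₁ 6
    have hQ₁13 : (C * P * (P / σ) ^ A) ^ 13 ≤ (P ^ u) ^ 13 := pow_le_pow_left₀ hQ₁0 hQ₁ 13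
    have hQ₂le : 25672 * (C * P * (P / σ) ^ A) ^ 6 ≤ P * (P ^ u) ^ 6 :=
      mul_le_mul h25672 hQ₁6 (by positivity) hP0.le
    have hQ₂pow : (25672 * (C * P * (P / σ) ^ A) ^ 6) ^ ((k + 1) * (k + 1)) ≤
        (P * (P ^ u) ^ 6) ^ ((k + 1) * (k + 1)) := pow_le_pow_left₀ (by positivity) hQ₂le _
    have hK₂le : 426133840896 * (C * P * (P / σ) ^ A) ^ 13 * (C * (P / σ) ^ A / ρ₁ ^ 2) ≤
        P * (P ^ u) ^ 13 * P ^ w :=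
      mul_le_mul (mul_le_mul hPbig hQ₁13 (by positivity) hP0.le) hK₁ hK₁0 (by positivity)
    have hXB : X + (1 + 13 * u + w) + 1 ≤ B := by rw [hB]; omega
    calc (25672 * (C * P * (P / σ) ^ A) ^ 6) ^ ((k + 1) * (k + 1)) *
          (426133840896 * (C * P * (P / σ) ^ A) ^ 13 * (C * (P / σ) ^ A / ρ₁ ^ 2)) * Ck ^ 2
        ≤ (P * (P ^ u) ^ 6) ^ ((k + 1) * (k + 1)) * (P * (P ^ u) ^ 13 * P ^ w) * P :=
          mul_le_mul (mul_le_mul hQ₂pow hK₂le (by positivity) (by positivity)) hPCk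
            (by positivity) (by positivity)
      _ = P ^ (X + (1 + 13 * u + w) + 1) := by rw [hX]; ring
      _ ≤ P ^ B := pow_le_pow_right₀ hP1 hXB
  · -- `(P^B)⁻¹ ≤ ρ₃`
    have hb₂B : b₂ + 1 ≤ B := by rw [hB]; omega
    calc (P ^ B)⁻¹ ≤ (P ^ (b₂ + 1))⁻¹ :=
          inv_anti₀ (by positivity) (pow_le_pow_right₀ hP1 hb₂B)
      _ = (P ^ b₂)⁻¹ / P := by rw [pow_succ]; field_simp
      _ ≤ (P ^ b₂)⁻¹ / Ck := div_le_div_of_nonneg_left (by positivity) hCkpos hPCk'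
      _ = ρ₂ / Ck := by rw [hρ₂]
  · -- `ρ₃ ≤ ρ`
    calc ρ₂ / Ck ≤ ρ₂ := div_le_self hρ₂pos.le hCk1
      _ ≤ ρ := hρ₂P.trans hρP
  · intro a b ha hb
    rw [hCk] at ha hb
    have h := hqb a b ha hb
    rw [natCast_zsmul] at h
    refine h.trans (le_of_eq ?_)
    rw [hCk]

end Summit.Parity.GeneralizedHardyLittlewood.GreenTaoLevelTwoMNTwoMajorArcOfPropTwentyTwo
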